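import Mathlib.Algebra.Algebra.Hom.Rat
import Mathlib.Data.Matrix.Basic
import Mathlib.LinearAlgebra.Dimension.Free
import Mathlib.LinearAlgebra.FiniteDimensional.Basic
import Mathlib.LinearAlgebra.FiniteDimensional.Lemmas
import Mathlib.RingTheory.Finiteness.Basic
import HarnessLib

/-!
# A field of degree `≥ n·[D : ℚ]` inside `Mat_n(D)`, `D` a division `ℚ`-algebra, forces `D` to be commutative

The linear-algebra core of G. Shimura, *Abelian Varieties with Complex Multiplication and Modular Functions*
(1998), §5.1 Propositions 3, 4 and 6 (pp. 37–39; Prop. 6: in characteristic `0`, «we have `g = 1` and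
`End_Q(B) = K`») and of D. Mumford, *Abelian Varieties* (1970), §19 (p. 174: `End⁰(A) = ⊕ M_{n_i}(D_i)`), isolated
from the geometry.  Usually one quotes «a maximal commutative subfield of the central simple algebra `Mat_n(D)` has
degree `n·d·[Z:ℚ]`, `[D:Z] = d²`»; the following ELEMENTARY substitute avoids central simple algebras altogether:

Let `D` be ANY nontrivial finite-dimensional `ℚ`-algebra (no division hypothesis is needed — for a division algebra
this is the classical case), `F` a field and `ψ : F → Mat_n(D)` a ring homomorphism (`0 < n`) with
`n · dim_ℚ D ≤ dim_ℚ F`.  The left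
ideal `L = Mat_n(D)·E₁₁` (matrices supported on the first column, `≅ Dⁿ`) is an `F`-vector space through `ψ` and
left multiplication, of `ℚ`-dimension `n · dim_ℚ D ≤ [F:ℚ]`, hence an `F`-LINE.  Right multiplication by a scalar
matrix `diag(d, …, d)` preserves `L` and is `F`-linear; endomorphisms of a line commute; reading the `(1,1)` entry of
`E₁₁·diag(d)·diag(d′) = E₁₁·diag(d′)·diag(d)` gives `dd′ = d′d`.  Hence:

* (private) `comp_comm_of_finrank_eq_one` — endomorphisms of a `1`-dimensional vector space over a field commute;
* `mul_comm_and_finrank_eq_of_field_ringHom_matrix` — the argument above, both conclusions at once;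
* **`mul_comm_of_field_ringHom_matrix`** — `D` is commutative;
* **`finrank_eq_mul_of_field_ringHom_matrix`** — and `[F : ℚ] = n · dim_ℚ D` (the inequality is an equality).

Consumer (cell `hodgecm-mathlib`, crux `HLiu418` = stmt-HodgeConjecture-24832, d6 S2′ road (6-i), «CM structure
passes to `k`-simple factors»): `D := End⁰_k(B₀)` for a `k`-simple isogeny factor `B₀` of an abelian variety
`X ~ B₀ⁿ` carrying a field `F ⊆ End⁰_k(X) ≅ Mat_n(End⁰_k(B₀))` of degree `2 dim X`; with
`dim_ℚ End⁰_k(B₀) ∣ 2 dim B₀` (`ComplexMultiplication/FieldOfDegreeTwoDimSimpleOverSubfield`) this file yields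
«`End⁰_k(B₀)` is a FIELD of degree `2 dim B₀`» ([Liu2021] App. D §D.4 l. 5626–5627, «`B_0` has complex
multiplications by `M_0`»).  Theorems only; no definition, no named fact, no instance, no `sorry`; pure Mathlib.

## References
* [Shimura1998] G. Shimura, *Abelian Varieties with Complex Multiplication and Modular Functions*, Princeton
  (1998), §5.1 Propositions 3 and 4 (p. 37), Proposition 6 (p. 39).
* [MumfordAV1970] D. Mumford, *Abelian Varieties* (1970), §19 Cor. 2 of Thm. 1 and the structure of `End⁰(X)`
  (p. 174).
-/

namespace Literature.RingTheory.SimpleModule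

open Module

universe u v w

/-! ### §1 Endomorphisms of a line commute -/

/-- **Two linear endomorphisms of a `1`-dimensional vector space over a (commutative) field commute** (each is a
homothety on a generator). [folklore] -/
private theorem comp_comm_of_finrank_eq_one {K : Type u} {V : Type v} [Field K] [AddCommGroup V]
    [Module K V] (h1 : finrank K V = 1) (g h : V →ₗ[K] V) : g ∘ₗ h = h ∘ₗ g := by
  obtain ⟨v, hv⟩ : ∃ v : V, v ≠ 0 := by
    by_contra! h0
    haveI : Subsingleton V := ⟨fun a b => by rw [h0 a, h0 b]⟩
    rw [Module.finrank_zero_of_subsingleton] at h1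
    exact zero_ne_one h1
  obtain ⟨a, ha⟩ := exists_smul_eq_of_finrank_eq_one h1 hv (g v)
  obtain ⟨b, hb⟩ := exists_smul_eq_of_finrank_eq_one h1 hv (h v)
  refine LinearMap.ext fun w => ?_
  obtain ⟨c, rfl⟩ := exists_smul_eq_of_finrank_eq_one h1 hv w
  simp only [LinearMap.coe_comp, Function.comp_apply, map_smul, ← ha, ← hb, smul_smul, mul_comm a b]

/-! ### §2 The left ideal `Mat_n(D)·E₁₁` as an `F`-line; commutativity of `D` -/

section Main

variable {D : Type u} [Ring D] [Algebra ℚ D] {n : ℕ}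

omit [Algebra ℚ D] in
/-- Right multiplication by the idempotent `E₁₁ = diag(1, 0, …, 0)` keeps the first column and kills the others (as a
diagonal matrix, so that only `Matrix.mul_diagonal` is needed). [folklore] -/
private theorem mul_e_apply (i0 : Fin n) (X : Matrix (Fin n) (Fin n) D) (i j : Fin n) :
    (X * Matrix.diagonal (fun l : Fin n => if l = i0 then (1 : D) else 0)) i j = if j = i0 then X i j else 0 := by
  rw [Matrix.mul_diagonal]
  split_ifs <;> simp

omit [Algebra ℚ D] in
/-- `diag(d, …, d)` commutes with `E₁₁`. [folklore] -/
private theorem diagonal_const_mul_e (i0 : Fin n) (d : D) :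
    Matrix.diagonal (fun _ : Fin n => d) * Matrix.diagonal (fun l : Fin n => if l = i0 then (1 : D) else 0) =
      Matrix.diagonal (fun l : Fin n => if l = i0 then (1 : D) else 0) * Matrix.diagonal (fun _ : Fin n => d) := by
  rw [Matrix.diagonal_mul_diagonal, Matrix.diagonal_mul_diagonal]
  congr 1
  funext l
  split_ifs <;> simp

variable [Nontrivial D] [Module.Finite ℚ D] {F : Type v} [Field F] [CharZero F] [Module.Finite ℚ F]

/-- **A field `F → Mat_n(D)` with `n · dim_ℚ D ≤ [F : ℚ]` forces `D` to be COMMUTATIVE and `[F : ℚ] = n · dim_ℚ D`**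
(Shimura §5.1 Prop. 6 «`g = 1`», elementary form: the left ideal `Mat_n(D)·E₁₁ ≅ Dⁿ` is an `F`-line on which the
right multiplications by scalars `d ∈ D` are commuting `F`-endomorphisms).
[cite: Shimura1998, §5.1 Propositions 3 and 4 (p. 37), Proposition 6 (p. 39)] [cite: MumfordAV1970, §19 (p. 174)] -/
theorem mul_comm_and_finrank_eq_of_field_ringHom_matrix (hn : 0 < n) (ψ : F →+* Matrix (Fin n) (Fin n) D)
    (hdeg : n * finrank ℚ D ≤ finrank ℚ F) :
    (∀ d d' : D, d * d' = d' * d) ∧ finrank ℚ F = n * finrank ℚ D := by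
  -- notation
  let E := Matrix (Fin n) (Fin n) D
  let i0 : Fin n := ⟨0, hn⟩
  let e : E := Matrix.diagonal (fun l : Fin n => if l = i0 then (1 : D) else 0)
  let Δ : D → E := fun x => Matrix.diagonal (fun _ : Fin n => x)
  have he : ∀ X : E, ∀ i j, (X * e) i j = if j = i0 then X i j else 0 := mul_e_apply i0
  -- `F` acts on `E` by left multiplication through `ψ` (a `ℚ`-algebra homomorphism)
  let ψa : F →ₐ[ℚ] E := ψ.toRatAlgHom
  letI : Module F E := Module.compHom E ψa.toRingHom
  have hsmul : ∀ (f : F) (X : E), f • X = ψa f * X := fun _ _ => rfl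
  haveI : IsScalarTower ℚ F E := ⟨fun q f X => by
    rw [hsmul, hsmul, map_smul, smul_mul_assoc]⟩
  haveI : Module.Finite F E := Module.Finite.of_restrictScalars_finite ℚ F E
  -- the left ideal `L = E·e`, an `F`-submodule
  let L : Submodule F E :=
    { carrier := {X | X * e = X}
      add_mem' := fun {X Y} hX hY => by
        simp only [Set.mem_setOf_eq] at hX hY ⊢; rw [add_mul, hX, hY]
      zero_mem' := by simp only [Set.mem_setOf_eq, zero_mul]
      smul_mem' := fun f X hX => by
        simp only [Set.mem_setOf_eq] at hX ⊢; rw [hsmul, mul_assoc, hX] }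
  have hmemL : ∀ X : E, X ∈ L ↔ X * e = X := fun X => Iff.rfl
  have hmemL' : ∀ X : E, X ∈ L ↔ ∀ i j, j ≠ i0 → X i j = 0 := fun X => by
    rw [hmemL]
    constructor
    · intro hX i j hj
      rw [← hX, he, if_neg hj]
    · intro hX
      ext i j
      rw [he]
      split_ifs with hj
      · rfl
      · exact (hX i j hj).symm
  haveI : Module.Finite F L := Module.Finite.of_injective L.subtype Subtype.val_injective
  -- `e ∈ L`, `e ≠ 0`
  have heL : e ∈ L := (hmemL' e).2 fun i j hj => by
    change Matrix.diagonal _ i j = 0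
    by_cases hij : i = j
    · subst hij; rw [Matrix.diagonal_apply_eq, if_neg hj]
    · rw [Matrix.diagonal_apply_ne _ hij]
  have hee : e i0 i0 = 1 := by
    change Matrix.diagonal _ i0 i0 = 1
    rw [Matrix.diagonal_apply_eq, if_pos rfl]
  have he0 : (⟨e, heL⟩ : L) ≠ 0 := by
    intro h0
    have h1 : e = 0 := by simpa using congrArg Subtype.val h0
    have h2 := congrFun (congrFun h1 i0) i0
    rw [hee, Matrix.zero_apply] at h2
    exact one_ne_zero h2
  haveI : Nontrivial L := ⟨⟨⟨e, heL⟩, 0, he0⟩⟩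
  -- `dim_ℚ L = n · dim_ℚ D`: `L ≅ (Fin n → D)`, `X ↦ (first column of X)`
  let col : L ≃ₗ[ℚ] (Fin n → D) :=
    { toFun := fun X => fun i => (X : E) i i0
      map_add' := fun X Y => by ext i; rfl
      map_smul' := fun q X => by ext i; rfl
      invFun := fun v => ⟨Matrix.of fun i j => if j = i0 then v i else 0,
        (hmemL' _).2 fun i j hj => by rw [Matrix.of_apply, if_neg hj]⟩
      left_inv := fun X => by
        apply Subtype.ext
        ext i j
        change (if j = i0 then (X : E) i i0 else 0) = (X : E) i j
        split_ifs with hj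
        · rw [hj]
        · exact (((hmemL' _).1 X.2) i j hj).symm
      right_inv := fun v => by
        ext i
        change (if i0 = i0 then v i else 0) = v i
        rw [if_pos rfl] }
  have hLQ : finrank ℚ L = n * finrank ℚ D := by
    rw [col.finrank_eq, Module.finrank_pi_fintype ℚ, Finset.sum_const, Finset.card_univ, Fintype.card_fin,
      smul_eq_mul]
  -- tower law: `[F:ℚ] · dim_F L = dim_ℚ L ≤ [F:ℚ]`, so `dim_F L = 1`
  have htower : finrank ℚ F * finrank F L = finrank ℚ L := Module.finrank_mul_finrank ℚ F L
  have hFpos : 0 < finrank ℚ F := finrank_pos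
  have hLpos : 0 < finrank F L := finrank_pos
  have hL1 : finrank F L = 1 := by
    have hle : finrank ℚ F * finrank F L ≤ finrank ℚ F * 1 := by rw [htower, hLQ, mul_one]; exact hdeg
    have := Nat.le_of_mul_le_mul_left hle hFpos
    omega
  refine ⟨fun d d' => ?_, by rw [← hLQ, ← htower, hL1, mul_one]⟩
  -- right multiplication by `diag(d, …, d)` on `L`, an `F`-linear endomorphism
  have hΔe : ∀ x : D, Δ x * e = e * Δ x := diagonal_const_mul_e i0
  have hmulΔ : ∀ x : D, ∀ X : E, X ∈ L → X * Δ x ∈ L := fun x X hX => by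
    rw [hmemL] at hX ⊢
    rw [mul_assoc, hΔe, ← mul_assoc, hX]
  let r : D → (L →ₗ[F] L) := fun x =>
    { toFun := fun X => ⟨(X : E) * Δ x, hmulΔ x X X.2⟩
      map_add' := fun X Y => Subtype.ext (add_mul _ _ _)
      map_smul' := fun f X => Subtype.ext (by
        change (ψa f * (X : E)) * Δ x = ψa f * ((X : E) * Δ x)
        rw [mul_assoc]) }
  -- endomorphisms of the line `L` commute; read the `(1,1)` entry of `e·Δ(d′)·Δ(d) = e·Δ(d)·Δ(d′)`
  have hcomm := comp_comm_of_finrank_eq_one hL1 (r d) (r d')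
  have h1 := congrArg (fun g : L →ₗ[F] L => ((g ⟨e, heL⟩ : L) : E) i0 i0) hcomm
  change (e * Matrix.diagonal (fun _ : Fin n => d') * Matrix.diagonal (fun _ : Fin n => d)) i0 i0 =
    (e * Matrix.diagonal (fun _ : Fin n => d) * Matrix.diagonal (fun _ : Fin n => d')) i0 i0 at h1
  rw [Matrix.mul_diagonal, Matrix.mul_diagonal, Matrix.mul_diagonal, Matrix.mul_diagonal, hee, one_mul,
    one_mul] at h1
  exact h1.symm

/-- **A field `F → Mat_n(D)` with `n · dim_ℚ D ≤ [F : ℚ]` (`0 < n`, `D` a nontrivial finite-dimensional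
`ℚ`-algebra) forces `D` to be COMMUTATIVE.** [cite: Shimura1998, §5.1 Proposition 6 (p. 39)] [cite: MumfordAV1970, §19 (p. 174)] -/
theorem mul_comm_of_field_ringHom_matrix (hn : 0 < n) (ψ : F →+* Matrix (Fin n) (Fin n) D)
    (hdeg : n * finrank ℚ D ≤ finrank ℚ F) (d d' : D) : d * d' = d' * d :=
  (mul_comm_and_finrank_eq_of_field_ringHom_matrix hn ψ hdeg).1 d d'

/-- … and **`[F : ℚ] = n · dim_ℚ D`**: the inequality is an equality. [cite: Shimura1998, §5.1 Proposition 4 (p. 37)] -/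
theorem finrank_eq_mul_of_field_ringHom_matrix (hn : 0 < n) (ψ : F →+* Matrix (Fin n) (Fin n) D)
    (hdeg : n * finrank ℚ D ≤ finrank ℚ F) : finrank ℚ F = n * finrank ℚ D :=
  (mul_comm_and_finrank_eq_of_field_ringHom_matrix hn ψ hdeg).2

end Main

end Literature.RingTheory.SimpleModule
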